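import Literature.MathematicalPhysics.QuantumLattice.TransferOperatorContraction
import Literature.MathematicalPhysics.QuantumLattice.RingCorrelationsTransfer
import Literature.MathematicalPhysics.QuantumLattice.RingCorrelationsBounds
import HarnessLib

/-!
# Discharged fact: exponential clustering of the periodic MPS of a normal tensor

Sibling proof file of `Literature/MathematicalPhysics/QuantumLattice/LiebRobinson.lean`. It
discharges the named fact (`def X : Prop`, D-0014)

* `Literature.MathematicalPhysics.QuantumLattice.fannes_nachtergaele_werner_decay` —
  **hubbard.S16**, Fannes–Nachtergaele–Werner exponential decay of correlations: for a normal MPS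
  tensor `A` of positive bond dimension there are `C`, `ξ > 0`, `L₀` such that for every ring
  `ℤ/L`, `L ≥ L₀`, sites `x, y` and single-site observables `a, b`,
  `|⟨a_x b_y⟩ - ⟨a_x⟩ ⟨b_y⟩| ≤ C ‖a‖ ‖b‖ e^{-ringDist x y / ξ}` in the periodic MPS
  `ψ_L = ringMPS L A` (normalised expectations),

as `fannes_nachtergaele_werner_decay_holds`. Theorems only: no statement of `LiebRobinson.lean`
is changed, no definition and no named fact is introduced.

## Source and proof

M. Fannes, B. Nachtergaele, R. F. Werner, *Finitely correlated states on quantum spin chains*,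
Comm. Math. Phys. **144** (1992) 443–490 (held: `paper:doi-10-1007-bf02099178`): eq. (3.1)
(p. 456: correlations of a finitely correlated state are `ρ(𝔼_{A₁} 𝔼^{m-2} 𝔼_{A_m}(𝟙))`, "computing
all powers of the matrix `𝔼`"), Prop. 3.1 (3) ⇒ (2) (p. 456: trivial peripheral spectrum ⇒
clustering) and Lemma 5.2 (p. 466–467: `‖𝔼ⁿ - 𝔼^∞‖ ≤ c λⁿ`, and the remainder expansion
`𝔼_A 𝔼ⁿ 𝔼_B = 𝔼_A 𝔼^∞ 𝔼_B + 𝔼_A 𝔼^∞(𝔼ⁿ - 𝔼^∞) + (𝔼ⁿ - 𝔼^∞) 𝔼_B 𝔼^∞ + …`). The vendored statement is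
the uniform-in-`L` periodic-ring corollary for a *normal* tensor (Perez-Garcia–Verstraete–Wolf–
Cirac, QIC **7** (2007) 401, §3.2: injective ⇒ primitive transfer operator, §3.2.2: ring
expectations via `E = Σ A^i ⊗ Ā^i`), assembled from the sibling files

* `TransferOperatorPerron`, `TransferOperatorDual`, `TransferOperatorMinorisation`,
  `TransferOperatorContraction` — Perron–Frobenius data `𝔼 X₀ = r₀ X₀`, `φ ∘ 𝔼 = r₀ φ`,
  `φ X₀ = 1` and the geometric convergence `‖(r₀⁻¹𝔼)ⁿ X - φ(X) X₀‖ ≤ C e^{-n/ξ} ‖X‖`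
  (`IsNormalMPS.exists_transferOp_pow_contraction`; FNW (5.1)/Lemma 5.2 for normal tensors);
* `RingCorrelationsTransfer` — `⟨ψ_L, ψ_L⟩ = Tr 𝔼^L`, `⟨ψ_L, a_x ψ_L⟩ = Tr 𝔼_a 𝔼^{L-1}`,
  `⟨ψ_L, a_x b_y ψ_L⟩ = Tr 𝔼_a 𝔼^m 𝔼_b 𝔼^n` at arc lengths `m + 1`, `n + 1` (FNW eq. (3.1)), and
  `ringDist x y = min (m, n) + 1`.

Here: with `T = r₀⁻¹ 𝔼`, `P X = φ(X) X₀` (`Tr P = 1`, `Tr (S P) = φ(S X₀)`,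
`Tr (S P S' P) = φ(S X₀) φ(S' X₀)`) and `R_n = Tⁿ - P`, all traces are bounded through the matrix
units (`norm_trace_end_le`) and `‖𝔼_g X‖ ≤ (Σ ‖A^j‖ ‖A^i‖) ‖g‖ ‖X‖` (`norm_transferOpGen_apply_le`,
both in `RingCorrelationsBounds`); `⟨ψ_L, ψ_L⟩ = r₀^L (1 + ε_L)` with `|ε_L| ≤ ½` for
`L ≥ L₀ = ⌈2κCξ⌉ + 2`; the normalised one- and two-point functions are `r₀⁻¹(α + δ)u` and
`r₀⁻²(α_a α_b + ρ)u` with `u = (1 + ε_L)⁻¹`, and the difference is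
`r₀⁻² u² (α_a α_b ε + ρ(1 + ε) - α_a δ_b - δ_a α_b - δ_a δ_b)` (`fnw_corr_identity`), each remainder
carrying a factor `e^{-min(m,n)/ξ} = e^{1/ξ} e^{-ringDist x y/ξ}` (`fnw_corr_bound`); the same-site
case `x = y` is bounded by a constant.

## References

* M. Fannes, B. Nachtergaele, R. F. Werner, Comm. Math. Phys. **144** (1992) 443–490,
  doi:10.1007/bf02099178, §3 eq. (3.1), Prop. 3.1; §5 (5.1), Lemma 5.2.
  [FannesNachtergaeleWernerCMP1992]
* D. Perez-Garcia, F. Verstraete, M. M. Wolf, J. I. Cirac, Quantum Inf. Comput. **7** (2007)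
  401–430, arXiv:quant-ph/0608197, §3.2 (Lemma 4, Thm. 5), §3.2.2.
  [PerezGarciaVerstraeteWolfCiracQIC2007]
-/

noncomputable section

open Matrix Filter Topology
open scoped ComplexOrder MatrixOrder Matrix.Norms.L2Operator

namespace Literature.MathematicalPhysics.QuantumLattice

section QLattice

variable {q D : ℕ}

/-! ### The discharge -/

-- The bookkeeping proof below is long (one-point, two-point and same-site estimates in one
-- declaration); it needs about twice the default heartbeat budget.
set_option maxHeartbeats 400000 in
/-- **Discharge of `fannes_nachtergaele_werner_decay`** (Fannes–Nachtergaele–Werner 1992,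
§3 Prop. 3.1 with eq. (3.1), §5 Lemma 5.2 — exponential clustering of the finitely correlated
state of a tensor whose transfer operator has trivial peripheral spectrum; for a *normal* tensor
this applies by Perez-Garcia–Verstraete–Wolf–Cirac 2007 §3.2 (injective ⇒ primitive), and the
uniform-in-`L` ring form is the corollary through the transfer-matrix expression of ring
correlations, loc. cit. §3.2.2). Proof: write `𝔼 = r₀ T` with `‖Tⁿ - P‖ ≤ C e^{-n/ξ}` pointwise,
`P X = φ(X) X₀`, `Tr P = 1` (`IsNormalMPS.exists_transferOp_pow_contraction`); by
`RingCorrelationsTransfer`, `⟨ψ_L, ψ_L⟩ = r₀^L Tr T^L = r₀^L (1 + ε_L)`,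
`⟨ψ_L, a_x ψ_L⟩ = r₀^{L-1} (φ(𝔼_a X₀) + Tr 𝔼_a R_{L-1})` and, for `x ≠ y` at arc lengths
`m + 1`, `n + 1`, `⟨ψ_L, a_x b_y ψ_L⟩ = r₀^{L-2} Tr (𝔼_a (P + R_m) 𝔼_b (P + R_n))` with
`Tr (𝔼_a P 𝔼_b P) = φ(𝔼_a X₀) φ(𝔼_b X₀)`; the remainders are `O(e^{-min(m,n)/ξ})`,
`|ε_L| ≤ ½` for `L ≥ L₀`, and `min (m, n) + 1 = ringDist x y`; the case `x = y` is bounded by a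
constant. This is the bookkeeping of FNW Lemma 5.2 (p. 467: `𝔼_A 𝔼ⁿ 𝔼_B = 𝔼_A 𝔼^∞ 𝔼_B +
𝔼_A 𝔼^∞ (𝔼ⁿ - 𝔼^∞) + …`). [cite: FannesNachtergaeleWernerCMP1992, §3 Prop. 3.1 and §5 Lemma 5.2] -/
theorem fannes_nachtergaele_werner_decay_holds :
    fannes_nachtergaele_werner_decay (q := q) (D := D) := by
  intro _ A hA
  obtain ⟨r₀, hr₀, X₀, φ, hX₀, hEX₀, hφX₀, hφE, C, ξ, hC, hξ, hbound⟩ :=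
    hA.exists_transferOp_pow_contraction
  -- abbreviations
  set T : Module.End ℂ (Matrix (Fin D) (Fin D) ℂ) := ((r₀⁻¹ : ℝ) : ℂ) • transferOp A with hT
  set P : Module.End ℂ (Matrix (Fin D) (Fin D) ℂ) := φ.smulRight X₀ with hP
  have hP_apply : ∀ X, P X = φ X • X₀ := fun X => LinearMap.smulRight_apply _ _ _
  set κ : ℝ := ∑ p : Fin D × Fin D, ‖Matrix.stdBasis ℂ (Fin D) (Fin D) p‖ with hκ
  set κA : ℝ := ∑ i : Fin q, ∑ j : Fin q, ‖A j‖ * ‖A i‖ with hκA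
  have hκ0 : 0 ≤ κ := Finset.sum_nonneg fun _ _ => norm_nonneg _
  have hκA0 : 0 ≤ κA := Finset.sum_nonneg fun _ _ =>
    Finset.sum_nonneg fun _ _ => mul_nonneg (norm_nonneg _) (norm_nonneg _)
  set Eg : Matrix (Fin q) (Fin q) ℂ → Module.End ℂ (Matrix (Fin D) (Fin D) ℂ) :=
    fun g => ∑ i : Fin q, ∑ j : Fin q, g i j • LinearMap.mulLeftRight ℂ (A j, (A i)ᴴ) with hEg
  have hEg_apply : ∀ g, Eg g =
      ∑ i : Fin q, ∑ j : Fin q, g i j • LinearMap.mulLeftRight ℂ (A j, (A i)ᴴ) := fun g => rfl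
  have hEg_le : ∀ g X, ‖Eg g X‖ ≤ κA * ‖g‖ * ‖X‖ := fun g X => norm_transferOpGen_apply_le A g X
  -- `𝔼^k = r₀^k T^k`
  have hEpow : ∀ k : ℕ, transferOp A ^ k = ((r₀ : ℂ) ^ k) • T ^ k := by
    intro k
    rw [hT, smul_pow, smul_smul, ← mul_pow, ← Complex.ofReal_mul, mul_inv_cancel₀ hr₀.ne',
      Complex.ofReal_one, one_pow, one_smul]
  have hr₀C : (r₀ : ℂ) ≠ 0 := by exact_mod_cast hr₀.ne'
  clear_value Eg P T κ κA
  -- remainders `R k = T^k - P`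
  have hR_le : ∀ (k : ℕ) X, ‖(T ^ k - P) X‖ ≤ C * Real.exp (-((k : ℝ) / ξ)) * ‖X‖ := by
    intro k X
    rw [LinearMap.sub_apply, hP_apply]
    exact hbound k X
  -- `φ` and `P` are bounded
  have hX₀0 : X₀ ≠ 0 := by
    rintro rfl
    rw [map_zero] at hφX₀
    exact zero_ne_one hφX₀
  have hX₀n : 0 < ‖X₀‖ := norm_pos_iff.mpr hX₀0
  have hφ_le : ∀ Y, ‖φ Y‖ ≤ (C + 1) / ‖X₀‖ * ‖Y‖ := by
    intro Y
    have h0 := hbound 0 Y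
    simp only [pow_zero, Module.End.one_apply, Nat.cast_zero, zero_div, neg_zero, Real.exp_zero,
      mul_one] at h0
    have h1 : ‖φ Y • X₀‖ ≤ (C + 1) * ‖Y‖ := by
      calc ‖φ Y • X₀‖ = ‖Y - (Y - φ Y • X₀)‖ := by rw [sub_sub_cancel]
        _ ≤ ‖Y‖ + ‖Y - φ Y • X₀‖ := norm_sub_le _ _
        _ ≤ ‖Y‖ + C * ‖Y‖ := by linarith
        _ = (C + 1) * ‖Y‖ := by ring
    rw [norm_smul] at h1
    rw [div_mul_eq_mul_div, le_div_iff₀ hX₀n]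
    exact h1
  have hP_le : ∀ X, ‖P X‖ ≤ (C + 1) * ‖X‖ := by
    intro X
    rw [hP_apply, norm_smul]
    have := hφ_le X
    rwa [div_mul_eq_mul_div, le_div_iff₀ hX₀n] at this
  -- trace identities for the rank-one map `P`
  have htrP : LinearMap.trace ℂ _ P = 1 := by rw [hP, LinearMap.trace_smulRight, hφX₀]
  have hSP : ∀ S : Module.End ℂ (Matrix (Fin D) (Fin D) ℂ), S * P = φ.smulRight (S X₀) := by
    intro S
    ext X : 1
    rw [Module.End.mul_apply, hP_apply, LinearMap.smulRight_apply, map_smul]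
  have htrSP : ∀ S : Module.End ℂ (Matrix (Fin D) (Fin D) ℂ),
      LinearMap.trace ℂ _ (S * P) = φ (S X₀) := by
    intro S
    rw [hSP, LinearMap.trace_smulRight]
  have htrSPSP : ∀ S S' : Module.End ℂ (Matrix (Fin D) (Fin D) ℂ),
      LinearMap.trace ℂ _ (S * P * (S' * P)) = φ (S X₀) * φ (S' X₀) := by
    intro S S'
    have h1 : S * P * (S' * P) = φ (S' X₀) • (S * P) := by
      ext X : 1
      simp only [Module.End.mul_apply, hP_apply, LinearMap.smul_apply, map_smul]
      module
    rw [h1, map_smul, htrSP, smul_eq_mul, mul_comm]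
  -- bounds on `α(c) = φ (𝔼_c X₀)` and `δ_k(c) = Tr (𝔼_c R_k)`
  have hα_le : ∀ c, ‖φ (Eg c X₀)‖ ≤ (C + 1) * κA * ‖c‖ := by
    intro c
    calc ‖φ (Eg c X₀)‖ ≤ (C + 1) / ‖X₀‖ * ‖Eg c X₀‖ := hφ_le _
      _ ≤ (C + 1) / ‖X₀‖ * (κA * ‖c‖ * ‖X₀‖) := by gcongr; exact hEg_le c X₀
      _ = (C + 1) * κA * ‖c‖ := by field_simp
  have hδ_le : ∀ c (k : ℕ), ‖LinearMap.trace ℂ _ (Eg c * (T ^ k - P))‖ ≤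
      κ * κA * ‖c‖ * C * Real.exp (-((k : ℝ) / ξ)) := by
    intro c k
    have hpt : ∀ X, ‖(Eg c * (T ^ k - P)) X‖ ≤
        (κA * ‖c‖ * (C * Real.exp (-((k : ℝ) / ξ)))) * ‖X‖ := by
      intro X
      rw [Module.End.mul_apply]
      calc ‖Eg c ((T ^ k - P) X)‖ ≤ κA * ‖c‖ * ‖(T ^ k - P) X‖ := hEg_le c _
        _ ≤ κA * ‖c‖ * (C * Real.exp (-((k : ℝ) / ξ)) * ‖X‖) := by gcongr; exact hR_le k X
        _ = _ := by ring
    refine (norm_trace_end_le _ hpt).trans_eq ?_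
    rw [← hκ]
    ring
  -- bound on the three remainder traces of the two-point function
  have hρ_le : ∀ (ca cb : Matrix (Fin q) (Fin q) ℂ) (m k : ℕ),
      ‖LinearMap.trace ℂ _ (Eg ca * P * (Eg cb * (T ^ k - P))) +
        LinearMap.trace ℂ _ (Eg ca * (T ^ m - P) * (Eg cb * P)) +
        LinearMap.trace ℂ _ (Eg ca * (T ^ m - P) * (Eg cb * (T ^ k - P)))‖ ≤
      κ * κA ^ 2 * ‖ca‖ * ‖cb‖ * ((C + 1) * C * Real.exp (-((k : ℝ) / ξ)) +
        C * Real.exp (-((m : ℝ) / ξ)) * (C + 1) +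
        C * Real.exp (-((m : ℝ) / ξ)) * (C * Real.exp (-((k : ℝ) / ξ)))) := by
    intro ca cb m k
    -- pointwise bounds for the three compositions
    have p1 : ∀ X, ‖(Eg ca * P * (Eg cb * (T ^ k - P))) X‖ ≤
        (κA * ‖ca‖ * (C + 1) * (κA * ‖cb‖) * (C * Real.exp (-((k : ℝ) / ξ)))) * ‖X‖ := by
      intro X
      simp only [Module.End.mul_apply]
      calc ‖Eg ca (P (Eg cb ((T ^ k - P) X)))‖
          ≤ κA * ‖ca‖ * ‖P (Eg cb ((T ^ k - P) X))‖ := hEg_le _ _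
        _ ≤ κA * ‖ca‖ * ((C + 1) * ‖Eg cb ((T ^ k - P) X)‖) := by gcongr; exact hP_le _
        _ ≤ κA * ‖ca‖ * ((C + 1) * (κA * ‖cb‖ * ‖(T ^ k - P) X‖)) := by
            gcongr; exact hEg_le _ _
        _ ≤ κA * ‖ca‖ * ((C + 1) * (κA * ‖cb‖ * (C * Real.exp (-((k : ℝ) / ξ)) * ‖X‖))) := by
            gcongr; exact hR_le k X
        _ = _ := by ring
    have p2 : ∀ X, ‖(Eg ca * (T ^ m - P) * (Eg cb * P)) X‖ ≤
        (κA * ‖ca‖ * (C * Real.exp (-((m : ℝ) / ξ))) * (κA * ‖cb‖) * (C + 1)) * ‖X‖ := by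
      intro X
      simp only [Module.End.mul_apply]
      calc ‖Eg ca ((T ^ m - P) (Eg cb (P X)))‖
          ≤ κA * ‖ca‖ * ‖(T ^ m - P) (Eg cb (P X))‖ := hEg_le _ _
        _ ≤ κA * ‖ca‖ * (C * Real.exp (-((m : ℝ) / ξ)) * ‖Eg cb (P X)‖) := by
            gcongr; exact hR_le m _
        _ ≤ κA * ‖ca‖ * (C * Real.exp (-((m : ℝ) / ξ)) * (κA * ‖cb‖ * ‖P X‖)) := by
            gcongr; exact hEg_le _ _
        _ ≤ κA * ‖ca‖ * (C * Real.exp (-((m : ℝ) / ξ)) * (κA * ‖cb‖ * ((C + 1) * ‖X‖))) := by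
            gcongr; exact hP_le X
        _ = _ := by ring
    have p3 : ∀ X, ‖(Eg ca * (T ^ m - P) * (Eg cb * (T ^ k - P))) X‖ ≤
        (κA * ‖ca‖ * (C * Real.exp (-((m : ℝ) / ξ))) * (κA * ‖cb‖) *
          (C * Real.exp (-((k : ℝ) / ξ)))) * ‖X‖ := by
      intro X
      simp only [Module.End.mul_apply]
      calc ‖Eg ca ((T ^ m - P) (Eg cb ((T ^ k - P) X)))‖
          ≤ κA * ‖ca‖ * ‖(T ^ m - P) (Eg cb ((T ^ k - P) X))‖ := hEg_le _ _
        _ ≤ κA * ‖ca‖ * (C * Real.exp (-((m : ℝ) / ξ)) * ‖Eg cb ((T ^ k - P) X)‖) := by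
            gcongr; exact hR_le m _
        _ ≤ κA * ‖ca‖ * (C * Real.exp (-((m : ℝ) / ξ)) * (κA * ‖cb‖ * ‖(T ^ k - P) X‖)) := by
            gcongr; exact hEg_le _ _
        _ ≤ κA * ‖ca‖ * (C * Real.exp (-((m : ℝ) / ξ)) *
              (κA * ‖cb‖ * (C * Real.exp (-((k : ℝ) / ξ)) * ‖X‖))) := by
            gcongr; exact hR_le k X
        _ = _ := by ring
    have q1 := norm_trace_end_le _ p1
    have q2 := norm_trace_end_le _ p2
    have q3 := norm_trace_end_le _ p3
    calc _ ≤ ‖LinearMap.trace ℂ _ (Eg ca * P * (Eg cb * (T ^ k - P)))‖ +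
          ‖LinearMap.trace ℂ _ (Eg ca * (T ^ m - P) * (Eg cb * P))‖ +
          ‖LinearMap.trace ℂ _ (Eg ca * (T ^ m - P) * (Eg cb * (T ^ k - P)))‖ :=
          norm_add₃_le
      _ ≤ _ := (add_le_add (add_le_add q1 q2) q3)
      _ = _ := by rw [← hκ]; ring
  -- the constants
  set K₁ : ℝ := 2 * κA * ((C + 1) + κ * C) / r₀ with hK₁
  set K₂ : ℝ := (r₀⁻¹) ^ 2 * (4 * ((C + 1) * κA * ((C + 1) * κA) * (κ * C) +
      κ * κA ^ 2 * ((C + 1) * C + C * (C + 1) + C * C) * (3 / 2) +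
      (C + 1) * κA * (κ * κA * C) + κ * κA * C * ((C + 1) * κA) +
      κ * κA * C * (κ * κA * C))) * Real.exp (1 / ξ) with hK₂
  have hK₁0 : 0 ≤ K₁ := by positivity
  have hK₂0 : 0 ≤ K₂ := by positivity
  clear_value K₁ K₂
  refine ⟨K₁ + K₁ ^ 2 + K₂, ξ, hξ, ⌈2 * κ * C * ξ⌉₊ + 2, ?_⟩
  intro L _ hL x y a b
  obtain ⟨L', rfl⟩ : ∃ L', L = L' + 1 := ⟨L - 1, by omega⟩
  have hL1 : 1 ≤ L' := by omega
  -- `ε = Tr (T^L - P)`, `|ε| ≤ κ C e^{-L/ξ} ≤ ½`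
  set ε : ℂ := LinearMap.trace ℂ _ (T ^ (L' + 1) - P) with hε
  have hε_le' : ‖ε‖ ≤ κ * C * Real.exp (-(((L' + 1 : ℕ) : ℝ) / ξ)) := by
    refine (norm_trace_end_le (T ^ (L' + 1) - P) (hR_le (L' + 1))).trans_eq ?_
    rw [← hκ]
    ring
  have hLpos : (0 : ℝ) < ((L' + 1 : ℕ) : ℝ) := by positivity
  have hexpL : Real.exp (-(((L' + 1 : ℕ) : ℝ) / ξ)) ≤ ξ / ((L' + 1 : ℕ) : ℝ) := by
    rw [Real.exp_neg, inv_le_comm₀ (Real.exp_pos _) (div_pos hξ hLpos), inv_div]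
    have h1 := Real.add_one_le_exp (((L' + 1 : ℕ) : ℝ) / ξ)
    linarith [div_pos hLpos hξ]
  have hε_le : ‖ε‖ ≤ 1 / 2 := by
    have hLge : (2 * κ * C * ξ : ℝ) ≤ ((L' + 1 : ℕ) : ℝ) := by
      have h1 : ((⌈2 * κ * C * ξ⌉₊ : ℕ) : ℝ) ≤ ((L' + 1 : ℕ) : ℝ) := by
        exact_mod_cast le_of_add_le_left hL
      exact (Nat.le_ceil _).trans h1
    calc ‖ε‖ ≤ κ * C * Real.exp (-(((L' + 1 : ℕ) : ℝ) / ξ)) := hε_le'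
      _ ≤ κ * C * (ξ / ((L' + 1 : ℕ) : ℝ)) := by gcongr
      _ = (2 * κ * C * ξ) / ((L' + 1 : ℕ) : ℝ) / 2 := by ring
      _ ≤ ((L' + 1 : ℕ) : ℝ) / ((L' + 1 : ℕ) : ℝ) / 2 := by gcongr
      _ = 1 / 2 := by rw [div_self hLpos.ne']
  have hN : LinearMap.trace ℂ _ (T ^ (L' + 1)) = 1 + ε := by
    rw [hε, map_sub, htrP]
    ring
  have hNn : 1 / 2 ≤ ‖(1 : ℂ) + ε‖ := by
    have := norm_sub_norm_le (1 : ℂ) (-ε)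
    rw [norm_one, norm_neg, sub_neg_eq_add] at this
    linarith
  have hN0 : (1 : ℂ) + ε ≠ 0 := fun h => by
    rw [h, norm_zero] at hNn
    linarith
  set u : ℂ := (1 + ε)⁻¹ with hu_def
  have hu : u * (1 + ε) = 1 := inv_mul_cancel₀ hN0
  have hu_le : ‖u‖ ≤ 2 := by
    rw [hu_def, norm_inv, inv_le_comm₀ (norm_pos_iff.mpr hN0) two_pos]
    linarith
  -- `⟨ψ, ψ⟩ = r₀^L (1 + ε)`
  have hnorm : opExpect 1 (ringMPS (L' + 1) A) = (r₀ : ℂ) ^ (L' + 1) * (1 + ε) := by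
    rw [opExpect_one_ringMPS, hEpow, map_smul, hN, smul_eq_mul]
  -- one-point functions: `⟨c_z⟩ = r₀⁻¹ (α(c) + δ_{L'}(c)) u`
  have hone : ∀ (z : ZMod (L' + 1)) (c : Matrix (Fin q) (Fin q) ℂ),
      opExpect (onSite z c) (ringMPS (L' + 1) A) / opExpect 1 (ringMPS (L' + 1) A) =
        (r₀ : ℂ)⁻¹ * (φ (Eg c X₀) + LinearMap.trace ℂ _ (Eg c * (T ^ L' - P))) * u := by
    intro z c
    rw [opExpect_onSite_ringMPS (L' + 1) L' rfl A z c, hnorm, ← hEg_apply c]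
    have h1 : LinearMap.trace ℂ _ (Eg c * T ^ L') =
        φ (Eg c X₀) + LinearMap.trace ℂ _ (Eg c * (T ^ L' - P)) := by
      rw [mul_sub, map_sub, htrSP]
      ring
    rw [hEpow L', mul_smul_comm, map_smul, smul_eq_mul, h1, div_eq_mul_inv, mul_inv, ← hu_def,
      pow_succ]
    field_simp
  have hone_le : ∀ (z : ZMod (L' + 1)) (c : Matrix (Fin q) (Fin q) ℂ),
      ‖opExpect (onSite z c) (ringMPS (L' + 1) A) / opExpect 1 (ringMPS (L' + 1) A)‖ ≤
        K₁ * ‖c‖ := by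
    intro z c
    rw [hone z c, norm_mul, norm_mul, norm_inv, Complex.norm_real, Real.norm_eq_abs,
      abs_of_pos hr₀]
    have h1 : ‖φ (Eg c X₀) + LinearMap.trace ℂ _ (Eg c * (T ^ L' - P))‖ ≤
        κA * ‖c‖ * ((C + 1) + κ * C) := by
      refine (norm_add_le _ _).trans ?_
      have h2 := hδ_le c L'
      have h3 : Real.exp (-((L' : ℝ) / ξ)) ≤ 1 := by
        rw [Real.exp_le_one_iff, neg_nonpos]
        positivity
      have h4 : κ * κA * ‖c‖ * C * Real.exp (-((L' : ℝ) / ξ)) ≤ κ * κA * ‖c‖ * C :=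
        mul_le_of_le_one_right (by positivity) h3
      have := hα_le c
      linarith
    calc r₀⁻¹ * ‖φ (Eg c X₀) + LinearMap.trace ℂ _ (Eg c * (T ^ L' - P))‖ * ‖u‖
        ≤ r₀⁻¹ * (κA * ‖c‖ * ((C + 1) + κ * C)) * 2 := by
          gcongr
      _ = K₁ * ‖c‖ := by rw [hK₁]; field_simp
  -- case distinction `x = y` / `x ≠ y`
  by_cases hxy : x = y
  · -- same site: everything is bounded, `ringDist x x = 0`
    subst hxy
    rw [onSite_mul, ringDist_eq, sub_self, ZMod.val_zero, Nat.zero_min]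
    simp only [Nat.cast_zero, neg_zero, zero_div, Real.exp_zero, mul_one]
    have key : ∀ w₁ w₂ w₃ : ℂ, ‖w₁‖ ≤ K₁ * ‖a * b‖ → ‖w₂‖ ≤ K₁ * ‖a‖ → ‖w₃‖ ≤ K₁ * ‖b‖ →
        ‖w₁ - w₂ * w₃‖ ≤ (K₁ + K₁ ^ 2 + K₂) * ‖a‖ * ‖b‖ := by
      intro w₁ w₂ w₃ h1 h2 h3
      calc ‖w₁ - w₂ * w₃‖ ≤ ‖w₁‖ + ‖w₂‖ * ‖w₃‖ := (norm_sub_le _ _).trans (by rw [norm_mul])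
        _ ≤ K₁ * ‖a * b‖ + K₁ * ‖a‖ * (K₁ * ‖b‖) :=
            add_le_add h1 (mul_le_mul h2 h3 (norm_nonneg _) (mul_nonneg hK₁0 (norm_nonneg _)))
        _ ≤ K₁ * (‖a‖ * ‖b‖) + K₁ * ‖a‖ * (K₁ * ‖b‖) := by
            gcongr
            exact norm_mul_le a b
        _ = (K₁ + K₁ ^ 2) * ‖a‖ * ‖b‖ := by ring
        _ ≤ (K₁ + K₁ ^ 2 + K₂) * ‖a‖ * ‖b‖ :=
            mul_le_mul_of_nonneg_right (mul_le_mul_of_nonneg_right (by linarith) (norm_nonneg a))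
              (norm_nonneg b)
    exact key _ _ _ (hone_le x (a * b)) (hone_le x a) (hone_le x b)
  · -- distinct sites: arc lengths `m + 1 = (y - x).val`, `k + 1 = (x - y).val`
    have hd0 : (y - x).val ≠ 0 := by
      intro h
      rw [ZMod.val_eq_zero, sub_eq_zero] at h
      exact hxy h.symm
    have hdL : (y - x).val < L' + 1 := ZMod.val_lt _
    obtain ⟨m, hm⟩ : ∃ m, (y - x).val = m + 1 := ⟨(y - x).val - 1, by omega⟩
    obtain ⟨k, hk⟩ : ∃ k, L' + 1 = m + k + 2 := ⟨L' - 1 - m, by omega⟩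
    have hρ0 := hρ_le a b m k
    -- two-point function: `⟨a_x b_y⟩ = r₀⁻² (α(a) α(b) + ρ) u`
    set ρ : ℂ := LinearMap.trace ℂ _ (Eg a * P * (Eg b * (T ^ k - P))) +
        LinearMap.trace ℂ _ (Eg a * (T ^ m - P) * (Eg b * P)) +
        LinearMap.trace ℂ _ (Eg a * (T ^ m - P) * (Eg b * (T ^ k - P))) with hρ
    have htwo : opExpect (onSite x a * onSite y b) (ringMPS (L' + 1) A) /
        opExpect 1 (ringMPS (L' + 1) A) =
        (r₀ : ℂ)⁻¹ ^ 2 * (φ (Eg a X₀) * φ (Eg b X₀) + ρ) * u := by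
      rw [opExpect_onSite_mul_onSite_ringMPS (L' + 1) m k hk A x y hm a b, hnorm, ← hEg_apply a,
        ← hEg_apply b]
      have ePm : P + (T ^ m - P) = T ^ m := by abel
      have ePk : P + (T ^ k - P) = T ^ k := by abel
      have h1 : LinearMap.trace ℂ _ (Eg a * T ^ m * (Eg b * T ^ k)) =
          φ (Eg a X₀) * φ (Eg b X₀) + ρ := by
        conv_lhs => rw [← ePm, ← ePk]
        rw [hρ]
        simp only [mul_add, add_mul, map_add, htrSPSP]
        ring
      rw [hEpow m, hEpow k, mul_smul_comm, mul_smul_comm, smul_mul_smul_comm, map_smul,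
        smul_eq_mul, h1, hk, div_eq_mul_inv, mul_inv, ← hu_def]
      field_simp
      ring
    -- instantiate the bounds, then treat all the pieces as atoms
    have hαa := hα_le a
    have hαb := hα_le b
    have hδa0 := hδ_le a L'
    have hδb0 := hδ_le b L'
    have hxa := hone x a
    have hyb := hone y b
    have hexp_mono : ∀ j : ℕ, min m k ≤ j →
        Real.exp (-((j : ℝ) / ξ)) ≤ Real.exp (-(((min m k : ℕ) : ℝ) / ξ)) := by
      intro j hj
      rw [Real.exp_le_exp, neg_le_neg_iff]
      exact div_le_div_of_nonneg_right (by exact_mod_cast hj) hξ.le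
    have hEm := hexp_mono m (min_le_left _ _)
    have hEk := hexp_mono k (min_le_right _ _)
    have hEL' := hexp_mono L' (by omega)
    have hEL := hexp_mono (L' + 1) (by omega)
    have hE1 : Real.exp (-(((min m k : ℕ) : ℝ) / ξ)) ≤ 1 := by
      rw [Real.exp_le_one_iff, neg_nonpos]
      positivity
    have hE0 : 0 ≤ Real.exp (-(((min m k : ℕ) : ℝ) / ξ)) := (Real.exp_pos _).le
    have hek1 : Real.exp (-((k : ℝ) / ξ)) ≤ 1 := by
      rw [Real.exp_le_one_iff, neg_nonpos]
      positivity
    have hem0 : 0 ≤ Real.exp (-((m : ℝ) / ξ)) := (Real.exp_pos _).le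
    have hek0 : 0 ≤ Real.exp (-((k : ℝ) / ξ)) := (Real.exp_pos _).le
    have hdist : Real.exp (-(ringDist x y : ℝ) / ξ) =
        Real.exp (-(1 / ξ)) * Real.exp (-(((min m k : ℕ) : ℝ) / ξ)) := by
      rw [ringDist_eq_min (L' + 1) m k hk x y hm, Nat.succ_min_succ, ← Real.exp_add]
      congr 1
      push_cast
      ring
    have hid := fnw_corr_identity (φ (Eg a X₀)) (φ (Eg b X₀))
      (LinearMap.trace ℂ _ (Eg a * (T ^ L' - P))) (LinearMap.trace ℂ _ (Eg b * (T ^ L' - P))) ρ ε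
      u ((r₀ : ℂ)⁻¹) hu
    rw [htwo, hxa, hyb, hid, hdist]
    clear htwo hxa hyb hid hdist hexp_mono
    set E : ℝ := Real.exp (-(((min m k : ℕ) : ℝ) / ξ)) with hE
    set em : ℝ := Real.exp (-((m : ℝ) / ξ)) with hem
    set ek : ℝ := Real.exp (-((k : ℝ) / ξ)) with hek
    set eL' : ℝ := Real.exp (-((L' : ℝ) / ξ)) with heL'
    set eL : ℝ := Real.exp (-(((L' + 1 : ℕ) : ℝ) / ξ)) with heL
    set αa : ℂ := φ (Eg a X₀) with hαa_def
    set αb : ℂ := φ (Eg b X₀) with hαb_def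
    set δa : ℂ := LinearMap.trace ℂ _ (Eg a * (T ^ L' - P)) with hδa_def
    set δb : ℂ := LinearMap.trace ℂ _ (Eg b * (T ^ L' - P)) with hδb_def
    clear_value E em ek eL' eL αa αb δa δb ρ
    -- the individual bounds with the common factor `E`
    have hδa : ‖δa‖ ≤ κ * κA * ‖a‖ * C * E :=
      hδa0.trans (mul_le_mul_of_nonneg_left hEL' (by positivity))
    have hδb : ‖δb‖ ≤ κ * κA * ‖b‖ * C * E :=
      hδb0.trans (mul_le_mul_of_nonneg_left hEL' (by positivity))
    have hεE : ‖ε‖ ≤ κ * C * E := hε_le'.trans (mul_le_mul_of_nonneg_left hEL (by positivity))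
    have hρE : ‖ρ‖ ≤ κ * κA ^ 2 * ‖a‖ * ‖b‖ * ((C + 1) * C + C * (C + 1) + C * C) * E := by
      refine hρ0.trans ?_
      have h1 : (C + 1) * C * ek ≤ (C + 1) * C * E := mul_le_mul_of_nonneg_left hEk (by positivity)
      have h2 : C * em * (C + 1) ≤ C * E * (C + 1) :=
        mul_le_mul_of_nonneg_right (mul_le_mul_of_nonneg_left hEm hC) (by positivity)
      have h4 : C * em * (C * ek) ≤ C * E * (C * 1) :=
        mul_le_mul (mul_le_mul_of_nonneg_left hEm hC) (mul_le_mul_of_nonneg_left hek1 hC)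
          (by positivity) (by positivity)
      have h3 : (C + 1) * C * ek + C * em * (C + 1) + C * em * (C * ek) ≤
          ((C + 1) * C + C * (C + 1) + C * C) * E := by linarith
      calc κ * κA ^ 2 * ‖a‖ * ‖b‖ * ((C + 1) * C * ek + C * em * (C + 1) + C * em * (C * ek))
          ≤ κ * κA ^ 2 * ‖a‖ * ‖b‖ * (((C + 1) * C + C * (C + 1) + C * C) * E) :=
            mul_le_mul_of_nonneg_left h3 (by positivity)
        _ = _ := by ring
    -- assemble
    rw [mul_assoc ((r₀ : ℂ)⁻¹ ^ 2), norm_mul ((r₀ : ℂ)⁻¹ ^ 2)]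
    have hr2 : ‖((r₀ : ℂ)⁻¹) ^ 2‖ = r₀⁻¹ ^ 2 := by
      rw [norm_pow, norm_inv, Complex.norm_real, Real.norm_eq_abs, abs_of_pos hr₀]
    rw [hr2]
    have hmain := fnw_corr_bound (by positivity) (by positivity) (by positivity) (by positivity)
      hE0 hE1 hαa hαb hδa hδb hρE hεE hε_le hu_le
    calc r₀⁻¹ ^ 2 * ‖u ^ 2 * (αa * αb * ε + ρ * (1 + ε) - αa * δb - δa * αb - δa * δb)‖
        ≤ r₀⁻¹ ^ 2 * (4 * ((C + 1) * κA * ‖a‖ * ((C + 1) * κA * ‖b‖) * (κ * C) +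
            κ * κA ^ 2 * ‖a‖ * ‖b‖ * ((C + 1) * C + C * (C + 1) + C * C) * (3 / 2) +
            (C + 1) * κA * ‖a‖ * (κ * κA * ‖b‖ * C) + κ * κA * ‖a‖ * C * ((C + 1) * κA * ‖b‖) +
            κ * κA * ‖a‖ * C * (κ * κA * ‖b‖ * C)) * E) :=
          mul_le_mul_of_nonneg_left hmain (by positivity)
      _ = K₂ * ‖a‖ * ‖b‖ * (Real.exp (-(1 / ξ)) * E) := by
          rw [hK₂, Real.exp_neg]
          field_simp
      _ ≤ (K₁ + K₁ ^ 2 + K₂) * ‖a‖ * ‖b‖ * (Real.exp (-(1 / ξ)) * E) := by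
          have h1 : K₂ ≤ K₁ + K₁ ^ 2 + K₂ := by linarith [sq_nonneg K₁]
          have h2 : 0 ≤ Real.exp (-(1 / ξ)) * E := mul_nonneg (Real.exp_pos _).le hE0
          exact mul_le_mul_of_nonneg_right (mul_le_mul_of_nonneg_right
            (mul_le_mul_of_nonneg_right h1 (norm_nonneg a)) (norm_nonneg b)) h2

end QLattice

end Literature.MathematicalPhysics.QuantumLattice
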